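import Literature.AnabelianGeometry.EtaleTheta.Discharge.Sec3Thm37SubQFT
import Literature.AlgebraicGeometry.Frobenioids.ModelFrobenioidSlimOfUnits
import HarnessLib

/-!
# [EtTh] Theorem 3.7 (iv) "`D` slim ⟹ `C` slim" for tempered Frobenioids — from `⋂ₙ O^×(A)ⁿ = 1` ALONE
# (no "`C` is a Frobenioid", no "`B` is a monoid on `D`")

S. Mochizuki, *The étale theta function and its Frobenioid-theoretic manifestations*, Publ. RIMS **45**
(2009), Theorem 3.7 (iv), PDF p. 80 [cite: MochizukiEtTh2009, Thm 3.7 p.80]: "If `D` is slim [cf. [FrdI],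
§0], and `Λ ∈ {ℤ, ℝ}`, then `C` is also slim" — seat abc-iut-L2-t3's named `Prop`
`TemperedFrobenioid.Thm37_iv` (FACT-LIST row **F-0744**), with the printed proof "[FrdI], Proposition 1.13,
(iii) [since, by Theorem 3.7 (i), condition (b) of loc. cit. is always satisfied]".

PROOF-ONLY companion (abc-iut cell, F fact-proving wave FLOAT, seat abc-iut-f-047; unseated tranche 137).
The instance forms of record — `thm37_iv_of_isFrobenioid (hF) (hdiv)` (`Sec3Thm37Holds.lean`),
`thm37_iv_treeCatVocab_of_isMonoidOn (hBmon) (hdiv)` — carry, besides the honest hypothesis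
`hdiv : ⋂ₙ O^×(A)ⁿ = 1` ("unit-profinite type", Thm. 3.7 (i); NECESSARY: seat abc-iut-f-049's interface
countermodel `TemperedFrobenioid.not_forall_thm37_iv` has divisible units), the input "`C → F_Φ` is a
Frobenioid" (`hF`, resp. `hBmon : IsMonoidOn B`, "`B` a monoid on `D`" — a property of the pull-backs of
`B₀^Λ` the interface does not record). THIS FILE removes it: the tempered Frobenioid IS the model category
`ModelFrobenioid Φ B Div_B` (`TemperedFrobenioid.category`), and [FrdI] Prop. 1.13 (iii)(b) holds for model
categories WITHOUT the Frobenioid axioms (`ModelFrobenioid.isSlim_of_sharp_of_forall_pow'`, seat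
abc-iut-f-047: sharp `Φ`, group-like `B`, `⋂ₙ O^×ⁿ = 1`, `D` slim ⇒ `C` slim). Hence:
* `thm37_iv_of_sharp` — Thm. 3.7 (iv) for EVERY inhabitant of the interface whose divisor monoids `Φ(A)`
  are sharp, from `hdiv` alone (`B` is group-like by the recorded `isUnit_BΛ`, `ratFn_isUnit`);
* `thm37_iv_treeCatVocab_of_hdiv` — at the canonical [FrdI] vocabulary `treeCatVocab` (`Φ` a divisorial
  monoid on `D`, hence objectwise sharp) from `hdiv` ALONE — supersedes `thm37_iv_treeCatVocab_of_isMonoidOn`.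
Together with abc-iut-f-049's countermodel this pins row F-0744 to exactly its honest hypothesis `hdiv`
(for sharp `Φ`). No definition; nothing here bears on [IUTchIII] Cor. 3.12; typed ≠ proved elsewhere.
-/

namespace Literature.AnabelianGeometry.EtaleTheta

open CategoryTheory Opposite Literature.AlgebraicGeometry.Frobenioids

universe u₀ v₀ u v w

variable {D₀ : Type u₀} [Category.{v₀} D₀] {V : FrdIMonoidStub.{w}}
  {T : RealifiedDivisorMonoids (D₀ := D₀) V} {D : Type u} [Category.{v} D]

namespace TemperedFrobenioid

section General

variable {VD : FrdICatStub.{u, v, w} D} (C₀ : TemperedFrobenioid T D VD)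

/-- **Thm. 3.7 (iv), "`D` slim ⟹ `C` slim", from `⋂ₙ O^×(A)ⁿ = 1` alone**, for every inhabitant of the
interface whose divisor monoids `Φ(A)` are sharp: [FrdI] Prop. 1.13 (iii)(b) for the model category
`C = ModelFrobenioid Φ B Div_B` WITHOUT the Frobenioid axioms (`ModelFrobenioid.isSlim_of_sharp_of_forall_pow'`);
`B` is group-like by `isUnit_BΛ` (`ratFn_isUnit`). No `hF`, no `hBmon`. [cite: MochizukiEtTh2009, Thm 3.7 p.80] -/
theorem isSlim_category_of_sharp (hΦ : ∀ A : D, IsSharp (C₀.Φ.carrier (op A)))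
    (hdiv : ∀ (X : C₀.category) (α : Aut X), α ∈ PreFrobenioid.unitsSubgroup C₀.toElem X →
      (∀ n : ℕ+, ∃ β : Aut X, β ∈ PreFrobenioid.unitsSubgroup C₀.toElem X ∧ β ^ (n : ℕ) = α) → α = 1)
    (hD : IsSlim D) : IsSlim C₀.category :=
  ModelFrobenioid.isSlim_of_sharp_of_forall_pow' hΦ (fun A q => C₀.ratFn_isUnit T.isUnit_BΛ (op A) q)
    hdiv hD

/-- **Thm. 3.7 (iv) as the named `Prop` `Thm37_iv`, from `hdiv` alone** (sharp divisor monoids): the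
monoid-type clause `Λ ∈ {ℤ, ℝ}` enters print only through `hdiv`. [cite: MochizukiEtTh2009, Thm 3.7 p.80] -/
theorem thm37_iv_of_sharp (hΦ : ∀ A : D, IsSharp (C₀.Φ.carrier (op A)))
    (hdiv : ∀ (X : C₀.category) (α : Aut X), α ∈ PreFrobenioid.unitsSubgroup C₀.toElem X →
      (∀ n : ℕ+, ∃ β : Aut X, β ∈ PreFrobenioid.unitsSubgroup C₀.toElem X ∧ β ^ (n : ℕ) = α) → α = 1) :
    C₀.Thm37_iv :=
  fun hD _ => C₀.isSlim_category_of_sharp hΦ hdiv hD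

end General

/-! ## At the canonical [FrdI] vocabulary: `Φ` divisorial on `D`, hence sharp — `hdiv` alone -/

section TreeVocab

variable {IsRational IsStrictlyRational : (Dᵒᵖ ⥤ CommMonCat.{w}) → Prop}
  (C₀ : TemperedFrobenioid T D (treeCatVocab D IsRational IsStrictlyRational))

/-- **Thm. 3.7 (iv) "`D` slim ⟹ `C` slim" at the canonical vocabulary, from `hdiv` ALONE** — the divisor
monoid is divisorial on `D` (field `isDivisorialOn` read in `treeCatVocab`), hence objectwise sharp; no
`hBmon : IsMonoidOn B` (cf. `isSlim_category_treeCatVocab`). [cite: MochizukiEtTh2009, Thm 3.7 p.80] -/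
theorem isSlim_category_treeCatVocab_of_hdiv
    (hdiv : ∀ (X : C₀.category) (α : Aut X), α ∈ PreFrobenioid.unitsSubgroup C₀.toElem X →
      (∀ n : ℕ+, ∃ β : Aut X, β ∈ PreFrobenioid.unitsSubgroup C₀.toElem X ∧ β ^ (n : ℕ) = α) → α = 1)
    (hD : IsSlim D) : IsSlim C₀.category :=
  C₀.isSlim_category_of_sharp (fun A => (C₀.isDivisorial_divisorMonoid A).isSharp) hdiv hD

/-- **Thm. 3.7 (iv) as the named `Prop` `Thm37_iv` at the canonical vocabulary, from `hdiv` ALONE** —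
supersedes `thm37_iv_treeCatVocab_of_isMonoidOn (hBmon) (hdiv)`: the instance form of FACT-LIST row F-0744
under exactly its honest hypothesis `⋂ₙ O^×(A)ⁿ = 1`. [cite: MochizukiEtTh2009, Thm 3.7 p.80] -/
theorem thm37_iv_treeCatVocab_of_hdiv
    (hdiv : ∀ (X : C₀.category) (α : Aut X), α ∈ PreFrobenioid.unitsSubgroup C₀.toElem X →
      (∀ n : ℕ+, ∃ β : Aut X, β ∈ PreFrobenioid.unitsSubgroup C₀.toElem X ∧ β ^ (n : ℕ) = α) → α = 1) :
    C₀.Thm37_iv :=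
  fun hD _ => C₀.isSlim_category_treeCatVocab_of_hdiv hdiv hD

end TreeVocab

end TemperedFrobenioid

end Literature.AnabelianGeometry.EtaleTheta
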